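import Summits.KontsevichZagierPeriods.KontsevichZagierPeriods.Theorems.SoloBlindTanHalf
import HarnessLib

/-!
# The zigzag transfer chart

Stanley's transfer map between the order polytope and the chain polytope of the cyclic zigzag
poset `0 < 1 > 2 < 3 > 0` (*Two poset polytopes*, Discrete Comput. Geom. 1 (1986), §3), written
in half-angle tangent coordinates `tᵢ = tan(uᵢ/2)`, `sᵢ = tan(θᵢ/2)`: on the half `{θ₀ < θ₂}` of
the order polytope `{0 < θ₀, θ₂ < θ₁, θ₃ < π/2}` the unimodular map `u = (θ₀, θ₁-θ₂, θ₂, θ₃-θ₂)`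
onto Beukers–Kolk–Calabi's `U = {uᵢ > 0, uᵢ + uᵢ₊₁ < π/2}` becomes the rational chart
`Ψ(s) = (s₀, M(s₁,s₂), s₂, M(s₃,s₂))`, `M(u,v) = (u-v)/(1+uv)` (tangent subtraction), a bijection
from the zigzag cell `O = {0 < s₀ < s₂ < s₁ < 1, s₂ < s₃ < 1}` onto the half `T₊ = T ∩ {t₀ < t₂}`
of the tangent cell of `SoloBlindTanHalf`, with inverse given by tangent addition.  Since
`1 + M(u,v)² = (1+u²)(1+v²)/(1+uv)²`, the angle volume form `w(t) = ∏ᵢ 2/(1+tᵢ²)` satisfies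
`w(Ψ s)·|det Ψ'(s)| = w(s)`: **`[O, w] ≡ [T₊, w]` is one move of rule (2)**
(`equivalent_of_zigChart`).
-/
noncomputable section

namespace Summit.KontsevichZagierPeriods.KontsevichZagierPeriods.Theorems

open Set MeasureTheory
open Literature.ModelTheory.ExponentialFields (IsSemialgebraic isSemialgebraic_setOf_eval_pos)
open MvPolynomial (aeval X C)
open Literature.NumberTheory.Transcendental
open Literature.NumberTheory.Transcendental.KZ

namespace SoloBlind

/-! ## Tangent subtraction and addition -/

/-- `M(u,v) = (u-v)/(1+uv)`: `tan(α-β)` in terms of `tan α`, `tan β`. -/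
def tSub (u v : ℝ) : ℝ := (u - v) / (1 + u * v)

/-- `A(p,v) = (p+v)/(1-pv)`: `tan(α+β)` in terms of `tan α`, `tan β`. -/
def tAdd (p v : ℝ) : ℝ := (p + v) / (1 - p * v)

/-- `∂M/∂u = (1+v²)/(1+uv)²`. -/
def dMu (u v : ℝ) : ℝ := (1 + v ^ 2) / (1 + u * v) ^ 2

/-- `∂M/∂v = -(1+u²)/(1+uv)²`. -/
def dMv (u v : ℝ) : ℝ := -(1 + u ^ 2) / (1 + u * v) ^ 2

section trig

variable {u v p : ℝ}

/-- `M(u,v) > 0` for `0 ≤ v < u`. -/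
theorem tSub_pos (hv : 0 ≤ v) (hvu : v < u) : 0 < tSub u v := by
  have hu : 0 ≤ u := by linarith
  exact div_pos (by linarith) (by positivity)

/-- `∂M/∂u > 0`. -/
theorem dMu_pos (huv : 0 < 1 + u * v) : 0 < dMu u v :=
  div_pos (by positivity) (pow_pos huv 2)

/-- **The addition law for the cell condition**: `M + v + Mv < 1 ↔ u < 1` (`M = M(u,v)`), from
`(1 - (M + v + Mv))(1 + uv) = (1 + v²)(1 - u)`. -/
theorem tSub_cond_iff (huv : 0 < 1 + u * v) : tSub u v + v + tSub u v * v < 1 ↔ u < 1 := by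
  have iden : (1 - (tSub u v + v + tSub u v * v)) * (1 + u * v) = (1 + v ^ 2) * (1 - u) := by
    unfold tSub; field_simp; ring
  have hv2 : (0 : ℝ) < 1 + v ^ 2 := by positivity
  constructor
  · intro h
    have h1 : 0 < (1 + v ^ 2) * (1 - u) := by rw [← iden]; exact mul_pos (by linarith) huv
    have h2 := (mul_pos_iff_of_pos_left hv2).mp h1
    linarith
  · intro h
    have h1 : 0 < (1 - (tSub u v + v + tSub u v * v)) * (1 + u * v) := by
      rw [iden]; exact mul_pos hv2 (by linarith)
    have h2 := (mul_pos_iff_of_pos_right huv).mp h1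
    linarith

/-- `A(M(u,v), v) = u`. -/
theorem tAdd_tSub (huv : 0 < 1 + u * v) : tAdd (tSub u v) v = u := by
  have h1 : 1 + u * v ≠ 0 := huv.ne'
  have h2 : 1 - tSub u v * v ≠ 0 := by
    rw [show 1 - tSub u v * v = (1 + v ^ 2) / (1 + u * v) by unfold tSub; field_simp; ring]
    exact div_ne_zero (by positivity) h1
  unfold tAdd; rw [div_eq_iff h2]; unfold tSub; field_simp; ring

/-- `M(A(p,v), v) = p`. -/
theorem tSub_tAdd (hpv : p * v < 1) : tSub (tAdd p v) v = p := by
  have h1 : 1 - p * v ≠ 0 := by linarith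
  have h2 : 1 + tAdd p v * v ≠ 0 := by
    rw [show 1 + tAdd p v * v = (1 + v ^ 2) / (1 - p * v) by unfold tAdd; field_simp; ring]
    exact div_ne_zero (by positivity) h1
  unfold tSub; rw [div_eq_iff h2]; unfold tAdd; field_simp; ring

/-- `v < A(p,v)` for `p > 0`, `pv < 1`. -/
theorem lt_tAdd (hp : 0 < p) (hpv : p * v < 1) : v < tAdd p v := by
  unfold tAdd
  rw [lt_div_iff₀ (by linarith)]
  nlinarith [sq_nonneg v, mul_pos hp (show (0 : ℝ) < 1 + v ^ 2 by positivity)]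

/-- `A(p,v) < 1 ↔ p + v + pv < 1` (`pv < 1`). -/
theorem tAdd_lt_one_iff (hpv : p * v < 1) : tAdd p v < 1 ↔ p + v + p * v < 1 := by
  unfold tAdd; rw [div_lt_one (by linarith)]; constructor <;> intro h <;> linarith

end trig

/-! ## The cells -/

/-- The lower half `T₊ = T ∩ {t₀ < t₂}` of the tangent cell. -/
def tanHalfCell : Set (Fin 4 → ℝ) := tanCell ∩ {t | t 0 < t 2}

/-- `T₊` is `ℚ`-semialgebraic. -/
theorem isSemialgebraic_tanHalfCell : IsSemialgebraic ℚ tanHalfCell := by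
  have h : {t : Fin 4 → ℝ | t 0 < t 2} =
      {t | 0 < aeval t (X 2 - X 0 : MvPolynomial (Fin 4) ℚ)} := by
    ext t; simp [sub_pos]
  rw [tanHalfCell, h]; exact isSemialgebraic_tanCell.inter (isSemialgebraic_setOf_eval_pos _)

/-- `T₊ ⊆ T`. -/
theorem tanHalfCell_subset : tanHalfCell ⊆ tanCell := inter_subset_left

/-- The zigzag order cell `O = {0 < s₀ < s₂ < s₁ < 1, s₂ < s₃ < 1}`. -/
def zigCell : Set (Fin 4 → ℝ) :=
  {s | 0 < s 0 ∧ s 0 < s 2 ∧ s 2 < s 1 ∧ s 1 < 1 ∧ s 2 < s 3 ∧ s 3 < 1}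

/-- `O` is `ℚ`-semialgebraic. -/
theorem isSemialgebraic_zigCell : IsSemialgebraic ℚ zigCell := by
  have h : zigCell =
      {s : Fin 4 → ℝ | 0 < aeval s (X 0 : MvPolynomial (Fin 4) ℚ)} ∩
      {s | 0 < aeval s (X 2 - X 0 : MvPolynomial (Fin 4) ℚ)} ∩
      {s | 0 < aeval s (X 1 - X 2 : MvPolynomial (Fin 4) ℚ)} ∩
      {s | 0 < aeval s (1 - X 1 : MvPolynomial (Fin 4) ℚ)} ∩
      {s | 0 < aeval s (X 3 - X 2 : MvPolynomial (Fin 4) ℚ)} ∩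
      {s | 0 < aeval s (1 - X 3 : MvPolynomial (Fin 4) ℚ)} := by
    ext s
    simp only [zigCell, mem_setOf_eq, mem_inter_iff, map_sub, map_one, MvPolynomial.aeval_X,
      sub_pos]
    tauto
  rw [h]
  exact (((((isSemialgebraic_setOf_eval_pos _).inter (isSemialgebraic_setOf_eval_pos _)).inter
    (isSemialgebraic_setOf_eval_pos _)).inter (isSemialgebraic_setOf_eval_pos _)).inter
    (isSemialgebraic_setOf_eval_pos _)).inter (isSemialgebraic_setOf_eval_pos _)

/-- `O` is measurable. -/
theorem measurableSet_zigCell : MeasurableSet zigCell :=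
  IsSemialgebraic.measurableSet_holds isSemialgebraic_zigCell

/-- `O` lies in the open unit box. -/
theorem zigCell_subset_kzOpenBox : zigCell ⊆ kzOpenBox 4 := by
  rintro s ⟨h0, h02, h21, h1, h23, h3⟩ i
  fin_cases i <;> simp only [Fin.zero_eta, Fin.isValue, Fin.mk_one, Fin.reduceFinMk, mem_Ioo] <;>
    constructor <;> linarith

/-! ## The chart and its inverse -/

/-- **The zigzag transfer chart** `Ψ(s) = (s₀, M(s₁,s₂), s₂, M(s₃,s₂))`. -/
def zigChart (s : Fin 4 → ℝ) : Fin 4 → ℝ := ![s 0, tSub (s 1) (s 2), s 2, tSub (s 3) (s 2)]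

/-- The inverse chart `Ψ⁻¹(t) = (t₀, A(t₁,t₂), t₂, A(t₃,t₂))`. -/
def zigInv (t : Fin 4 → ℝ) : Fin 4 → ℝ := ![t 0, tAdd (t 1) (t 2), t 2, tAdd (t 3) (t 2)]

section coords

variable (s : Fin 4 → ℝ)

/-- Coordinate `0` of `Ψ`. -/
@[simp] theorem zigChart_zero : zigChart s 0 = s 0 := rfl
/-- Coordinate `1` of `Ψ`. -/
@[simp] theorem zigChart_one : zigChart s 1 = tSub (s 1) (s 2) := rfl
/-- Coordinate `2` of `Ψ`. -/
@[simp] theorem zigChart_two : zigChart s 2 = s 2 := rfl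
/-- Coordinate `3` of `Ψ`. -/
@[simp] theorem zigChart_three : zigChart s 3 = tSub (s 3) (s 2) := rfl
/-- Coordinate `0` of `Ψ⁻¹`. -/
@[simp] theorem zigInv_zero : zigInv s 0 = s 0 := rfl
/-- Coordinate `1` of `Ψ⁻¹`. -/
@[simp] theorem zigInv_one : zigInv s 1 = tAdd (s 1) (s 2) := rfl
/-- Coordinate `2` of `Ψ⁻¹`. -/
@[simp] theorem zigInv_two : zigInv s 2 = s 2 := rfl
/-- Coordinate `3` of `Ψ⁻¹`. -/
@[simp] theorem zigInv_three : zigInv s 3 = tAdd (s 3) (s 2) := rfl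

end coords

/-- **`Ψ` maps `O` into `T₊`** (the addition law, and monotonicity of `c(a,b) = a + b + ab`). -/
theorem zigChart_mem {s : Fin 4 → ℝ} (hs : s ∈ zigCell) : zigChart s ∈ tanHalfCell := by
  obtain ⟨h0, h02, h21, h1, h23, h3⟩ := hs
  have hs2 : 0 ≤ s 2 := by linarith
  have h12 : 0 < 1 + s 1 * s 2 := by nlinarith
  have h32 : 0 < 1 + s 3 * s 2 := by nlinarith
  have hM1 : 0 < tSub (s 1) (s 2) := tSub_pos hs2 h21
  have hM3 : 0 < tSub (s 3) (s 2) := tSub_pos hs2 h23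
  have hc1 := (tSub_cond_iff h12).mpr h1
  have hc3 := (tSub_cond_iff h32).mpr h3
  have hm1 : tSub (s 1) (s 2) * s 0 < tSub (s 1) (s 2) * s 2 := mul_lt_mul_of_pos_left h02 hM1
  have hm3 : tSub (s 3) (s 2) * s 0 < tSub (s 3) (s 2) * s 2 := mul_lt_mul_of_pos_left h02 hM3
  refine ⟨fun i => ?_, h02⟩
  fin_cases i <;>
    simp only [Fin.zero_eta, Fin.isValue, Fin.mk_one, Fin.reduceFinMk, Fin.reduceAdd,
      zigChart_zero, zigChart_one, zigChart_two, zigChart_three]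
  · exact ⟨h0, by linarith⟩
  · exact ⟨hM1, hc1⟩
  · exact ⟨by linarith, by linarith⟩
  · exact ⟨hM3, by linarith⟩

/-- **`Ψ⁻¹` maps `T₊` into `O`.** -/
theorem zigInv_mem {t : Fin 4 → ℝ} (ht : t ∈ tanHalfCell) : zigInv t ∈ zigCell := by
  obtain ⟨ht, h02⟩ := ht
  have hp : ∀ i, 0 < t i := fun i => (ht i).1
  have hl : ∀ i, t i < 1 := lt_one_of_mem_tanCell ht
  have hpv : ∀ i j, t i * t j < 1 := fun i j =>
    mul_lt_one_of_nonneg_of_lt_one_left (hp i).le (hl i) (hl j).le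
  have hc1 : t 1 + t 2 + t 1 * t 2 < 1 := (ht 1).2
  have hc3 : t 3 + t 2 + t 3 * t 2 < 1 := by
    have h := (ht 2).2; simp only [Fin.reduceAdd] at h; linarith
  refine ⟨hp 0, h02, lt_tAdd (hp 1) (hpv 1 2), (tAdd_lt_one_iff (hpv 1 2)).mpr hc1,
    lt_tAdd (hp 3) (hpv 3 2), (tAdd_lt_one_iff (hpv 3 2)).mpr hc3⟩

/-- `Ψ ∘ Ψ⁻¹ = id` on `T₊`. -/
theorem zigChart_zigInv {t : Fin 4 → ℝ} (ht : t ∈ tanHalfCell) : zigChart (zigInv t) = t := by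
  obtain ⟨ht, _⟩ := ht
  have hpv : ∀ i j, t i * t j < 1 := fun i j =>
    mul_lt_one_of_nonneg_of_lt_one_left (ht i).1.le (lt_one_of_mem_tanCell ht i)
      (lt_one_of_mem_tanCell ht j).le
  funext i; fin_cases i; exacts [rfl, tSub_tAdd (hpv 1 2), rfl, tSub_tAdd (hpv 3 2)]

/-- `Ψ⁻¹ ∘ Ψ = id` on `O`. -/
theorem zigInv_zigChart {s : Fin 4 → ℝ} (hs : s ∈ zigCell) : zigInv (zigChart s) = s := by
  obtain ⟨h0, h02, h21, h1, h23, h3⟩ := hs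
  have h12 : 0 < 1 + s 1 * s 2 := by nlinarith
  have h32 : 0 < 1 + s 3 * s 2 := by nlinarith
  funext i; fin_cases i; exacts [rfl, tAdd_tSub h12, rfl, tAdd_tSub h32]

/-- **`Ψ` is injective on `O`.** -/
theorem injOn_zigChart : InjOn zigChart zigCell := fun a ha b hb h => by
  rw [← zigInv_zigChart ha, ← zigInv_zigChart hb, h]

/-- **`Ψ` maps `O` onto `T₊`.** -/
theorem image_zigChart : zigChart '' zigCell = tanHalfCell :=
  Subset.antisymm (image_subset_iff.mpr fun _ hs => zigChart_mem hs)
    fun t ht => ⟨zigInv t, zigInv_mem ht, zigChart_zigInv ht⟩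

/-- `Ψ` is a `ℚ`-rational, hence `ℚ`-semialgebraic, map on `O`. -/
theorem isSemialgebraicMapOn_zigChart : IsSemialgebraicMapOn ℚ zigCell zigChart := by
  have hq : ∀ i : Fin 4, ∀ s ∈ zigCell,
      aeval s (1 + X i * X 2 : MvPolynomial (Fin 4) ℚ) ≠ 0 := by
    intro i s hs
    have hb := zigCell_subset_kzOpenBox hs
    have h : (0 : ℝ) < 1 + s i * s 2 := by nlinarith [(hb i).1, (hb 2).1]
    simpa using h.ne'
  refine IsSemialgebraicMapOn.of_forall isSemialgebraic_zigCell fun i => ?_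
  fin_cases i
  · exact (isSemialgebraicFunOn_aeval isSemialgebraic_zigCell (X 0)).congr fun s _ => by simp
  · exact (isSemialgebraicFunOn_aeval_div_aeval isSemialgebraic_zigCell (X 1 - X 2)
      (1 + X 1 * X 2) (hq 1)).congr fun s _ => by simp [tSub]
  · exact (isSemialgebraicFunOn_aeval isSemialgebraic_zigCell (X 2)).congr fun s _ => by simp
  · exact (isSemialgebraicFunOn_aeval_div_aeval isSemialgebraic_zigCell (X 3 - X 2)
      (1 + X 3 * X 2) (hq 3)).congr fun s _ => by simp [tSub]

/-! ## The derivative and its determinant -/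

/-- Derivative of a tangent-subtraction coordinate `y ↦ M(yᵢ, yⱼ)`. -/
theorem hasFDerivAt_tSub_coord {s : Fin 4 → ℝ} (i j : Fin 4) (h : 0 < 1 + s i * s j) :
    HasFDerivAt (fun y : Fin 4 → ℝ => tSub (y i) (y j))
      (dMu (s i) (s j) • ContinuousLinearMap.proj (R := ℝ) (φ := fun _ : Fin 4 => ℝ) i +
        dMv (s i) (s j) • ContinuousLinearMap.proj (R := ℝ) (φ := fun _ : Fin 4 => ℝ) j) s := by
  have hN : HasFDerivAt (fun y : Fin 4 → ℝ => y i - y j)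
      (ContinuousLinearMap.proj (R := ℝ) (φ := fun _ : Fin 4 => ℝ) i -
        ContinuousLinearMap.proj (R := ℝ) (φ := fun _ : Fin 4 => ℝ) j) s :=
    (hasFDerivAt_apply i s).sub (hasFDerivAt_apply j s)
  have hD : HasFDerivAt (fun y : Fin 4 → ℝ => 1 + y i * y j)
      (s i • ContinuousLinearMap.proj (R := ℝ) (φ := fun _ : Fin 4 => ℝ) j +
        s j • ContinuousLinearMap.proj (R := ℝ) (φ := fun _ : Fin 4 => ℝ) i) s :=
    ((hasFDerivAt_apply i s).mul (hasFDerivAt_apply j s)).const_add 1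
  have hI : HasFDerivAt (fun y : Fin 4 → ℝ => (1 + y i * y j)⁻¹)
      ((-((1 + s i * s j) ^ 2)⁻¹) •
        (s i • ContinuousLinearMap.proj (R := ℝ) (φ := fun _ : Fin 4 => ℝ) j +
          s j • ContinuousLinearMap.proj (R := ℝ) (φ := fun _ : Fin 4 => ℝ) i)) s :=
    HasDerivAt.comp_hasFDerivAt (h₂ := fun z : ℝ => z⁻¹) (f := fun y : Fin 4 → ℝ => 1 + y i * y j)
      s (hasDerivAt_inv h.ne') hD
  have hf : (fun y : Fin 4 → ℝ => tSub (y i) (y j)) =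
      fun y => (y i - y j) * (1 + y i * y j)⁻¹ := funext fun y => div_eq_mul_inv _ _
  rw [hf]
  refine (hN.mul hI).congr_fderiv (ContinuousLinearMap.ext fun w => ?_)
  have h' : 1 + s i * s j ≠ 0 := h.ne'
  simp [dMu, dMv]
  field_simp
  ring

/-- The rows of `DΨ(s)`. -/
def zigRow (s : Fin 4 → ℝ) : Fin 4 → ((Fin 4 → ℝ) →L[ℝ] ℝ) :=
  ![ContinuousLinearMap.proj (R := ℝ) (φ := fun _ : Fin 4 => ℝ) 0,
    dMu (s 1) (s 2) • ContinuousLinearMap.proj (R := ℝ) (φ := fun _ : Fin 4 => ℝ) 1 +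
      dMv (s 1) (s 2) • ContinuousLinearMap.proj (R := ℝ) (φ := fun _ : Fin 4 => ℝ) 2,
    ContinuousLinearMap.proj (R := ℝ) (φ := fun _ : Fin 4 => ℝ) 2,
    dMu (s 3) (s 2) • ContinuousLinearMap.proj (R := ℝ) (φ := fun _ : Fin 4 => ℝ) 3 +
      dMv (s 3) (s 2) • ContinuousLinearMap.proj (R := ℝ) (φ := fun _ : Fin 4 => ℝ) 2]

/-- The derivative `DΨ(s)`. -/
def zigDeriv (s : Fin 4 → ℝ) : (Fin 4 → ℝ) →L[ℝ] (Fin 4 → ℝ) :=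
  ContinuousLinearMap.pi (zigRow s)

/-- **`Ψ` is differentiable on `O` with derivative `zigDeriv`.** -/
theorem hasFDerivAt_zigChart {s : Fin 4 → ℝ} (hs : s ∈ zigCell) :
    HasFDerivAt zigChart (zigDeriv s) s := by
  obtain ⟨h0, h02, h21, h1, h23, h3⟩ := hs
  have h12 : 0 < 1 + s 1 * s 2 := by nlinarith
  have h32 : 0 < 1 + s 3 * s 2 := by nlinarith
  rw [hasFDerivAt_pi']
  intro i
  have hrow : (ContinuousLinearMap.proj (R := ℝ) (φ := fun _ : Fin 4 => ℝ) i).comp (zigDeriv s) =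
      zigRow s i := ContinuousLinearMap.ext fun w => by simp [zigDeriv]
  rw [hrow]
  fin_cases i
  · simpa [zigRow, zigChart] using hasFDerivAt_apply (0 : Fin 4) s
  · simpa [zigRow, zigChart] using hasFDerivAt_tSub_coord 1 2 h12
  · simpa [zigRow, zigChart] using hasFDerivAt_apply (2 : Fin 4) s
  · simpa [zigRow, zigChart] using hasFDerivAt_tSub_coord 3 2 h32

/-- Determinant of the shape of `DΨ`. -/
theorem det_zigShape (a b c d : ℝ) :
    !![(1 : ℝ), 0, 0, 0; 0, a, b, 0; 0, 0, 1, 0; 0, 0, c, d].det = a * d := by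
  rw [Matrix.det_succ_row_zero]
  simp [Fin.sum_univ_succ, Matrix.det_fin_three, Fin.succ_zero_eq_one, Fin.succ_one_eq_two]

/-- The matrix of `DΨ(s)`. -/
theorem toMatrix_zigDeriv (s : Fin 4 → ℝ) :
    LinearMap.toMatrix' ((zigDeriv s : (Fin 4 → ℝ) →L[ℝ] (Fin 4 → ℝ)) :
      (Fin 4 → ℝ) →ₗ[ℝ] (Fin 4 → ℝ)) =
      !![(1 : ℝ), 0, 0, 0; 0, dMu (s 1) (s 2), dMv (s 1) (s 2), 0; 0, 0, 1, 0;
        0, 0, dMv (s 3) (s 2), dMu (s 3) (s 2)] := by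
  ext i j
  rw [LinearMap.toMatrix'_apply, ContinuousLinearMap.coe_coe]
  fin_cases i <;> fin_cases j <;> simp [zigDeriv, zigRow]

/-- **The Jacobian** `det DΨ(s) = ∂₁M(s₁,s₂) · ∂₁M(s₃,s₂)`. -/
theorem det_zigDeriv (s : Fin 4 → ℝ) :
    (zigDeriv s).det = dMu (s 1) (s 2) * dMu (s 3) (s 2) := by
  rw [ContinuousLinearMap.det, ← LinearMap.det_toMatrix', toMatrix_zigDeriv, det_zigShape]

/-- On `O` the Jacobian is positive. -/
theorem abs_det_zigDeriv {s : Fin 4 → ℝ} (hs : s ∈ zigCell) :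
    |(zigDeriv s).det| = dMu (s 1) (s 2) * dMu (s 3) (s 2) := by
  obtain ⟨h0, h02, h21, h1, h23, h3⟩ := hs
  rw [det_zigDeriv]
  exact abs_of_pos (mul_pos (dMu_pos (by nlinarith)) (dMu_pos (by nlinarith)))

/-! ## The move -/

/-- The angle weight `w(t) = ∏ᵢ W(tᵢ) = ∏ᵢ 2/(1+tᵢ²)` (`∏ dθᵢ` in half-angle tangents). -/
def tanWeight (t : Fin 4 → ℝ) : ℝ := ∏ i, tW (t i)

/-- Unfolding the weight. -/
theorem tanWeight_eq (t : Fin 4 → ℝ) : tanWeight t = ∏ i, tW (t i) := rfl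

/-- The weight is positive. -/
theorem tanWeight_pos (t : Fin 4 → ℝ) : 0 < tanWeight t :=
  Finset.prod_pos fun i _ => tW_pos (t i)

/-- The weight is invariant under coordinate permutations. -/
theorem tanWeight_perm (σ : Equiv.Perm (Fin 4)) (t : Fin 4 → ℝ) :
    tanWeight (fun i => t (σ i)) = tanWeight t := by
  unfold tanWeight
  exact Fintype.prod_equiv σ (fun i => tW (t (σ i))) (fun i => tW (t i)) fun _ => rfl

/-- The weight is continuous. -/
theorem continuous_tanWeight : Continuous tanWeight := by
  unfold tanWeight tW
  refine continuous_finsetProd _ fun i _ => ?_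
  exact continuous_const.div ((continuous_const.add ((continuous_apply i).pow 2)))
    fun t => (by positivity : (0 : ℝ) < 1 + t i ^ 2).ne'

/-- **The transfer identity** `w(s) = w(Ψ s)·|det Ψ'(s)|`
(from `1 + M(u,v)² = (1+u²)(1+v²)/(1+uv)²`). -/
theorem tanWeight_zigChart {s : Fin 4 → ℝ} (hs : s ∈ zigCell) :
    tanWeight s = tanWeight (zigChart s) * (dMu (s 1) (s 2) * dMu (s 3) (s 2)) := by
  obtain ⟨h0, h02, h21, h1, h23, h3⟩ := hs
  have h12 : 1 + s 1 * s 2 ≠ 0 := by nlinarith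
  have h32 : 1 + s 3 * s 2 ≠ 0 := by nlinarith
  have h32' : 1 + s 2 * s 3 ≠ 0 := by nlinarith
  unfold tanWeight
  rw [Fin.prod_univ_four, Fin.prod_univ_four]
  simp only [zigChart_zero, zigChart_one, zigChart_two, zigChart_three]
  unfold tW tSub dMu
  field_simp
  ring

/-- **One move of rule (2) along the transfer chart**: `[O, w] ≡ [T₊, w]` for representations
pinned by their data. -/
theorem equivalent_of_zigChart {r r' : IntegralRep 4} (hrd : r.domain = zigCell)
    (hri : EqOn r.integrand tanWeight zigCell) (hr'd : r'.domain = tanHalfCell)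
    (hr'i : EqOn r'.integrand tanWeight tanHalfCell) : Equivalent r r' :=
  equivalent_of_chart isSemialgebraicMapOn_zigChart (fun _ hs => hasFDerivAt_zigChart hs)
    injOn_zigChart image_zigChart (fun _ hs => abs_det_zigDeriv hs)
    (fun _ hs => tanWeight_zigChart hs) hrd hri hr'd hr'i

end SoloBlind

end Summit.KontsevichZagierPeriods.KontsevichZagierPeriods.Theorems
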